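import Mathlib
import HarnessLib
import Summits.ResolutionOfSingularities.ResolutionOfSingularities.Theorems.WildQuotientsWildQuotientResolutionS1aQhSymAbsRoot
import Summits.ResolutionOfSingularities.ResolutionOfSingularities.Theorems.WildQuotientsWildQuotientResolutionS1aQhAbsCover

/-!
# S1a — R4c brick (i), cover half: the NORM COVER of the root with two moving generators, `(f₀^{n₀}, N(f₁)^{n₁}, N(f₂)^{n₂})`

[OURS · L1 W4.5c · lead-1 g17; plan-1 RULING R-F15v, SPEC `Lines/s1a_logminvertex-R4c-SPEC.md` §1 (1O) COVER: for the moving generators `τfⱼ = fⱼ + f₀` with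
shifts `eⱼ = w₀ − wⱼ` (`e₂ = sh`, `e₁ ≥ sh`) the norms `N(fⱼ) = ∏_l (fⱼ + l·f₀)` are `τ`-fixed elements of `𝒥_{p·wⱼ}`, their powers are cover elements
`cⱼ = (∏_l (uⱼ′ + l·u₀′s^{eⱼ}))^{nⱼ}` at the common degree `dbar = p·wⱼ·nⱼ`, and `u₀′, u₁′, u₂′ ∈ √(c₀, c₁, c₂)` (hrad); generalises ✓`qha_norm_one_*` /
✓`qha_coverElement_one_eq` / ✓`qha_hrad` (exponent `sh` only)] — NOT statements of the manuscript; counted 0; AI-level work, weaker than expert review. Crux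
stmt-ResolutionOfSingularities-17941 `CyclicQuotientFourfolds`, line `s1a-logminvertex` v13 (`stub_reachLowerInFX`).
-/

set_option linter.dupNamespace false

noncomputable section

open Literature.AlgebraicGeometry.Resolution
open scoped LaurentPolynomial
open Summit.ResolutionOfSingularities.ResolutionOfSingularities.Theorems.WildQuotientResolution.S1.CoarseChart
open Summit.ResolutionOfSingularities.ResolutionOfSingularities.Theorems.WildQuotientResolution.S1.BlowupCharts
open Summit.ResolutionOfSingularities.ResolutionOfSingularities.Theorems.WildQuotientResolution.S1.GameFrame.GModel

namespace Summit.ResolutionOfSingularities.ResolutionOfSingularities.Theorems.WildQuotientResolution.S1.KillCert.QhSym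

variable {L : Type} [CommRing L] (τ : L ≃+* L) (f : Fin 3 → L) (w : Fin 3 → ℕ) (j : Fin 3) (hwj : w j ≤ w 0)

/-! ## The norm of a moving generator -/

include hwj in
/-- `N(fⱼ) = ∏_l (fⱼ + l·f₀) ∈ 𝒥_{p·wⱼ}` whenever `wⱼ ≤ w₀`. -/
theorem qs_norm_mem {p : ℕ} [NeZero p] : (∏ i : ZMod p, (f j + (i.val : L) * f 0)) ∈ (weightedFiltration f w).ideal (p * w j) := by
  have hX0 : f 0 ∈ (weightedFiltration f w).ideal (w j) := (weightedFiltration _ _).antitone hwj (mem_weightedFiltration_ideal f w 0)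
  have hfac : ∀ i : ZMod p, f j + (i.val : L) * f 0 ∈ (weightedFiltration f w).ideal (w j) :=
    fun i => add_mem (mem_weightedFiltration_ideal f w j) (Ideal.mul_mem_left _ _ hX0)
  have h := Ideal.prod_mem_prod (s := (Finset.univ : Finset (ZMod p))) (fun i _ => hfac i)
  rw [Finset.prod_const, Finset.card_univ, ZMod.card] at h
  have hle := Veronese.idealFiltration_pow_le (weightedFiltration f w) (w j) p
  rw [Nat.mul_comm (w j) p] at hle
  exact hle h

include hwj in
/-- The norm cover element: `N(fⱼ)ⁿ ∈ 𝒥_{dbar}` for `dbar = p·wⱼ·n`. -/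
theorem qs_cover_mem {p : ℕ} [NeZero p] (n dbar : ℕ) (hdbar : dbar = p * w j * n) : (∏ i : ZMod p, (f j + (i.val : L) * f 0)) ^ n ∈ (weightedFiltration f w).ideal dbar := by
  have h := Ideal.pow_mem_pow (qs_norm_mem f w j hwj (p := p)) n
  have hle := Veronese.idealFiltration_pow_le (weightedFiltration f w) (p * w j) n
  rw [← hdbar] at hle
  exact hle h

/-- The norm is `τ`-fixed (`τ f₀ = f₀`, `τ fⱼ = fⱼ + f₀`; characteristic `p ≠ 1`), and so are its powers. -/
theorem qs_cover_fixed {p : ℕ} [NeZero p] [CharP L p] (hp1 : p ≠ 1) (h0 : τ (f 0) = f 0) (hj : τ (f j) = f j + f 0) (n : ℕ) :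
    τ ((∏ i : ZMod p, (f j + (i.val : L) * f 0)) ^ n) = (∏ i : ZMod p, (f j + (i.val : L) * f 0)) ^ n := by
  rw [map_pow]
  exact congrArg (· ^ n) (QhAbs.qha_norm_one_fixed τ (![f 0, f j, 0] : Fin 3 → L) h0 hj hp1)

include hwj in
/-- `N(fⱼ)·T^{p·wⱼ} = ∏_l (uⱼ″ + l·(u₀″·T^{−(w₀−wⱼ)}))` in `L[T;T⁻¹]`. -/
theorem qs_norm_T {p : ℕ} [NeZero p] : LaurentPolynomial.C (∏ i : ZMod p, (f j + (i.val : L) * f 0)) * LaurentPolynomial.T ((p * w j : ℕ) : ℤ) =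
    ∏ i : ZMod p, (LaurentPolynomial.C (f j) * LaurentPolynomial.T ((w j : ℕ) : ℤ) +
      (i.val : L[T;T⁻¹]) * (LaurentPolynomial.C (f 0) * LaurentPolynomial.T ((w 0 : ℕ) : ℤ) * LaurentPolynomial.T (-(((w 0 - w j : ℕ)) : ℤ)))) := by
  have hfac : ∀ i : ZMod p, LaurentPolynomial.C (f j) * LaurentPolynomial.T ((w j : ℕ) : ℤ) +
      (i.val : L[T;T⁻¹]) * (LaurentPolynomial.C (f 0) * LaurentPolynomial.T ((w 0 : ℕ) : ℤ) * LaurentPolynomial.T (-(((w 0 - w j : ℕ)) : ℤ))) =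
      LaurentPolynomial.C (f j + (i.val : L) * f 0) * LaurentPolynomial.T ((w j : ℕ) : ℤ) := by
    intro i
    rw [mul_assoc, ← LaurentPolynomial.T_add, map_add, map_mul, map_natCast]
    have e1 : ((w 0 : ℕ) : ℤ) + -(((w 0 - w j : ℕ)) : ℤ) = ((w j : ℕ) : ℤ) := by omega
    rw [e1]; ring
  simp_rw [hfac]
  rw [Finset.prod_mul_distrib, ← map_prod, Finset.prod_const, Finset.card_univ, ZMod.card, LaurentPolynomial.T_pow]
  push_cast
  ring_nf

variable {m : ℕ} (mo : Fin m → ℕ) (𝒜 : (Π j : Fin m, ZMod (mo j)) → AddSubgroup L) [GradedRing 𝒜]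
  {dbar : ℕ} (y : ↥(𝒜 0)) (hy : y ∈ (traceFiltration 𝒜 f w).ideal dbar)

include hwj in
/-- **The norm cover element in `R^w`**: `c = (∏_l (uⱼ′ + l·(u₀′ s^{w₀−wⱼ})))ⁿ` when `(y : L) = N(fⱼ)ⁿ` and `dbar = p·wⱼ·n`. -/
theorem qs_coverElement_eq {p : ℕ} [NeZero p] (n : ℕ) (hdbar : dbar = p * w j * n) (hyval : (y : L) = (∏ i : ZMod p, (f j + (i.val : L) * f 0)) ^ n) :
    coverElement 𝒜 f w dbar y hy =
      (∏ i : ZMod p, (cobordantAlgebra.u' f w j + algebraMap L _ (i.val : L) * (cobordantAlgebra.u' f w 0 * cobordantAlgebra.s f w ^ (w 0 - w j)))) ^ n := by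
  refine Subtype.ext ?_
  rw [SubmonoidClass.coe_pow, SubmonoidClass.coe_finsetProd, coe_coverElement, hyval, hdbar]
  have hi : ∀ i : ZMod p, ((cobordantAlgebra.u' f w j + algebraMap L _ (i.val : L) * (cobordantAlgebra.u' f w 0 * cobordantAlgebra.s f w ^ (w 0 - w j)) : ↥(cobordantAlgebra f w)) : L[T;T⁻¹]) =
      LaurentPolynomial.C (f j) * LaurentPolynomial.T ((w j : ℕ) : ℤ) + (i.val : L[T;T⁻¹]) * (LaurentPolynomial.C (f 0) * LaurentPolynomial.T ((w 0 : ℕ) : ℤ) * LaurentPolynomial.T (-(((w 0 - w j : ℕ)) : ℤ))) := by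
    intro i
    rw [AddMemClass.coe_add, MulMemClass.coe_mul, MulMemClass.coe_mul, cobordantAlgebra.coe_u', cobordantAlgebra.coe_u', cobordantAlgebra.coe_s_pow,
      cobordantAlgebra.coe_algebraMap, map_natCast]
  simp_rw [hi]
  rw [← qs_norm_T f w j hwj (p := p), mul_pow, ← map_pow, LaurentPolynomial.T_pow]
  congr 2
  push_cast
  ring

/-! ## hrad for the norm cover `(u₀′^{n₀}, c₁, c₂)` -/

/-- ★ **`hrad` for the two-moving-generator cover**: `c₀ = u₀′^{n₀}`, `cⱼ = (∏_l (uⱼ′ + l·(u₀′ s^{eⱼ})))^{nⱼ}` (`nⱼ > 0`, `j = 1, 2`): all three generators lie in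
`√(c₀, c₁, c₂)`. [OURS · L1 W4.5c · R4c brick (i)] -/
theorem qs_hrad {p : ℕ} [NeZero p] (c : Fin 3 → ↥(cobordantAlgebra f w)) {n₀ n₁ n₂ : ℕ} (hn₁ : 0 < n₁) (hn₂ : 0 < n₂) (e₁ e₂ : ℕ)
    (hc₀ : c 0 = cobordantAlgebra.u' f w 0 ^ n₀)
    (hc₁ : c 1 = (∏ i : ZMod p, (cobordantAlgebra.u' f w 1 + algebraMap L _ (i.val : L) * (cobordantAlgebra.u' f w 0 * cobordantAlgebra.s f w ^ e₁))) ^ n₁)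
    (hc₂ : c 2 = (∏ i : ZMod p, (cobordantAlgebra.u' f w 2 + algebraMap L _ (i.val : L) * (cobordantAlgebra.u' f w 0 * cobordantAlgebra.s f w ^ e₂))) ^ n₂) (l : Fin 3) :
    cobordantAlgebra.u' f w l ∈ (Ideal.span (Set.range c)).radical := by
  have hr0 : cobordantAlgebra.u' f w 0 ∈ (Ideal.span (Set.range c)).radical := ⟨n₀, by rw [← hc₀]; exact Ideal.subset_span ⟨0, rfl⟩⟩
  have hgen : ∀ (jj : Fin 3) (e nn : ℕ), 0 < nn →
      c jj = (∏ i : ZMod p, (cobordantAlgebra.u' f w jj + algebraMap L _ (i.val : L) * (cobordantAlgebra.u' f w 0 * cobordantAlgebra.s f w ^ e))) ^ nn →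
      cobordantAlgebra.u' f w jj ∈ (Ideal.span (Set.range c)).radical := by
    intro jj e nn hnn hc
    have hB : cobordantAlgebra.u' f w 0 * cobordantAlgebra.s f w ^ e ∈ (Ideal.span (Set.range c)).radical := Ideal.mul_mem_right _ _ hr0
    have hP : (∏ i : ZMod p, (cobordantAlgebra.u' f w jj + algebraMap L _ (i.val : L) * (cobordantAlgebra.u' f w 0 * cobordantAlgebra.s f w ^ e))) ∈
        (Ideal.span (Set.range c)).radical := by
      refine Ideal.mem_radical_of_pow_mem (m := nn) ?_
      rw [← hc]; exact Ideal.le_radical (Ideal.subset_span ⟨jj, rfl⟩)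
    have _ := hnn
    exact Sym.mem_radical_of_prod_add_mul _ _ _ (fun i => algebraMap L _ (i.val : L)) hB hP
  fin_cases l
  · exact hr0
  · exact hgen 1 e₁ n₁ hn₁ hc₁
  · exact hgen 2 e₂ n₂ hn₂ hc₂

end Summit.ResolutionOfSingularities.ResolutionOfSingularities.Theorems.WildQuotientResolution.S1.KillCert.QhSym

end
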